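import Summits.QuantumFields.YangMills.Theorems.SwapVirialDeficitZeroModeSigmaFourSmallBallCone
import Literature.MathematicalPhysics.QuantumLattice.SU2HaarChart
import HarnessLib

/-!
# The SPEED of the gnomonic blow-up (brick S-B, part 1, of fcl-p3 g45's virial SPEC): every letter quaternion moves at speed `≤ 1/2` along the dilation
# `s ↦ quatToSU2 (±(1, e^s v))`, words of `k` letters at speed `≤ k/2`
# (free-hands support of ⟨stmt-QuantumFields-24197⟩ `SwapVirialDeficit.SwapGluedStiffness`)

fcl-p3 g45's SPEC (ym-idea-1 STATUS 13:18:22Z), brick S-B: the virial identity's integrand `(X F̂)·e^{−bF̂}` needs `|X F̂| ≤ C_L`, i.e. a bound on the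
`s`-derivative of the deficit along the gnomonic blow-up `η ↦ e^s η`.  The deficit is a finite sum of plaquette ∕ coupling ∕ seam terms `2 − 2 re(word)`,
each word a product of letter quaternions `su2Quat (quatToSU2 (±(1, e^s η_ℓ)))` of norm `1`; so `C_L` follows from a PER-LETTER speed bound and the
product rule.  This file (part 1 of S-B, ring-independent):

* §1 ★ `hasDerivAt_gnomonicQuat_exp` — `d/ds (1, e^s v) = (1, e^s v) − 1` (`gnomonicQuat_smul`: `(1, c·v) = 1 + c·((1,v) − 1)`; `re (1,v) = 1` is ✓`re_gnomonicQuat`, here `rfl`);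
* §2 ★★ `norm_radialDeriv_le_half` — for `re p = 1`: `‖‖p‖⁻¹·P_p(p − 1)‖ ≤ 1/2` (Pythagoras `‖P_p 1‖² = 1 − ‖p‖⁻²` for the tangential projection of
  ✓`Literature.Analysis.Calculus.RadialCalculus`; the speed is `r/(1+r²) ≤ 1/2`, `r = |Im p|`);
* §3 ★★ `hasDerivAt_radialUnit_gnomonic` ∕ `norm_deriv_radialUnit_gnomonic_le` (✓`hasFDerivAt_radialUnit` ∘ §1; speed `≤ 1/2`), and for the signed SPEC
  letter `gnoLetter ε v = (±1)·(1, v)`: `su2Quat_quatToSU2_smul_gnomonicQuat` (`= c·ν((1,w))`, `|c| = 1`), ★★ `hasDerivAt_letterQuat` ∕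
  ★ `norm_deriv_letterQuat_le` — `‖d/ds su2Quat (quatToSU2 (c·(1, e^s v)))‖ ≤ 1/2`; `norm_letterQuat` (`= 1`);
* §4 words: ★ `hasDerivAt_mul_norm_le` ∕ `exists_hasDerivAt_mul_norm_le` — norm-`≤ 1` paths with speeds `≤ a, b` multiply to speed `≤ a + b` (so a word of
  `k` letters has speed `≤ k/2`); with ✓`Literature….abs_re_le_norm` (`|re q| ≤ ‖q‖`) this gives `|d/ds (2 − 2 re w)| ≤ 2·(k/2) = k`.  Part 2 (the `O(L⁴)` bookkeeping over
  ✓`BlowUp.qDeficit`'s sums giving an explicit `C_L`) belongs with the virial assembly.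

HONEST LABEL: calculus plumbing for the window programme of a DRAFT line; no statement about the ring; ⟨24197⟩ (window-uniform) ∕ ⟨24194⟩ ∕ ⟨24497⟩ OPEN;
own crux ⟨22884⟩ OPEN (blocked-on ⟨19935⟩); no crux, rung of record or summit is proved; the Yang–Mills mass gap is NOT proved; no summit is proved by a line.
THEOREMS ONLY (0 `def`, 0 `sorry`), standard axioms.  Width seat ym-line-sfw-p2-w2 g57 (cell ym-idea-1, free hands), `--supports stmt-QuantumFields-24197`.
References: [folklore].
-/

set_option autoImplicit false

noncomputable section

open Quaternion
open scoped Quaternion RealInnerProductSpace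
open Literature.MathematicalPhysics.QuantumLattice
open Literature.Analysis.Calculus (radialUnit radialUnit_def norm_radialUnit tangentialProj tangentialProj_apply tangentialProj_apply_self
  inner_tangentialProj inner_tangentialProj_comm tangentialProj_idem hasFDerivAt_radialUnit)
open Summit.QuantumFields.YangMills.Theorems.SwapVirialDeficit.ZeroModeSigma (su2Quat_quatToSU2_eq_radialUnit)

namespace Summit.QuantumFields.YangMills.Theorems.SwapVirialDeficit.Gnomonic

/-! ## §1 The gnomonic dilation path `s ↦ (1, e^s v)` -/

/-- `(1, c·v) = 1 + c·((1, v) − 1)` in `ℍ`. [folklore] -/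
theorem gnomonicQuat_smul (c : ℝ) (v : Fin 3 → ℝ) : gnomonicQuat (c • v) = 1 + c • (gnomonicQuat v - 1) := by
  ext <;> simp [gnomonicQuat]

/-- ★ **The gnomonic dilation path is differentiable**: `d/ds (1, e^s v) = (0, e^s v) = (1, e^s v) − 1`. [folklore] -/
theorem hasDerivAt_gnomonicQuat_exp (v : Fin 3 → ℝ) (s : ℝ) :
    HasDerivAt (fun s : ℝ => gnomonicQuat (Real.exp s • v)) (gnomonicQuat (Real.exp s • v) - 1) s := by
  have h : HasDerivAt (fun s : ℝ => (1 : ℍ) + Real.exp s • (gnomonicQuat v - 1)) (Real.exp s • (gnomonicQuat v - 1)) s := by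
    have h1 := ((Real.hasDerivAt_exp s).smul_const (gnomonicQuat v - 1)).const_add (1 : ℍ)
    simpa using h1
  have e : (fun s : ℝ => gnomonicQuat (Real.exp s • v)) = fun s => (1 : ℍ) + Real.exp s • (gnomonicQuat v - 1) :=
    funext fun s => gnomonicQuat_smul _ v
  rw [e]
  convert h using 1
  rw [gnomonicQuat_smul, add_sub_cancel_left]

/-! ## §2 The speed of the radial projection of a quaternion with real part `1` -/

/-- `⟨p, 1⟩ = re p`. [folklore] -/
theorem inner_one_right (p : ℍ) : ⟪p, (1 : ℍ)⟫ = p.re := by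
  rw [Quaternion.inner_def, star_one, mul_one]

/-- For `re p = 1`: `1 ≤ ‖p‖²` (`‖p‖² = re² + |Im p|²`). [folklore] -/
theorem one_le_sq_norm_of_re {p : ℍ} (hp : p.re = 1) : 1 ≤ ‖p‖ ^ 2 := by
  rw [sq, ← Quaternion.normSq_eq_norm_mul_self, Quaternion.normSq_def']
  have h1 := sq_nonneg p.imI
  have h2 := sq_nonneg p.imJ
  have h3 := sq_nonneg p.imK
  show 1 ≤ p.re ^ 2 + p.imI ^ 2 + p.imJ ^ 2 + p.imK ^ 2
  rw [hp]; linarith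

/-- `‖P_p 1‖² = 1 − ‖p‖⁻²` when `re p = 1` (Pythagoras for the tangential projection: `P` self-adjoint and idempotent, `⟨p, 1⟩ = 1`). [folklore] -/
theorem sq_norm_tangentialProj_one {p : ℍ} (hp : p.re = 1) : ‖tangentialProj p (1 : ℍ)‖ ^ 2 = 1 - (‖p‖ ^ 2)⁻¹ := by
  rw [← real_inner_self_eq_norm_sq, ← inner_tangentialProj_comm, tangentialProj_idem, inner_tangentialProj, real_inner_self_eq_norm_sq,
    inner_one_right, hp, norm_one]
  ring

/-- ★★ **THE SPEED BOUND**: for `re p = 1`, `‖‖p‖⁻¹·P_p(p − 1)‖ ≤ 1/2` — the speed `r/(1+r²)` (`r = |Im p|`) of the radial projection along the gnomonic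
dilation is at most `1/2`. [folklore] -/
theorem norm_radialDeriv_le_half {p : ℍ} (hp : p.re = 1) : ‖(‖p‖⁻¹ • tangentialProj p) (p - 1)‖ ≤ 1 / 2 := by
  have hN := one_le_sq_norm_of_re hp
  have hNpos : 0 < ‖p‖ ^ 2 := lt_of_lt_of_le one_pos hN
  have h1 : tangentialProj p (p - 1) = -(tangentialProj p (1 : ℍ)) := by
    rw [map_sub, tangentialProj_apply_self, zero_sub]
  have hsq : ‖(‖p‖⁻¹ • tangentialProj p) (p - 1)‖ ^ 2 = (‖p‖ ^ 2)⁻¹ * (1 - (‖p‖ ^ 2)⁻¹) := by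
    rw [FunLike.coe_smul, Pi.smul_apply, h1, norm_smul, norm_neg, norm_inv, norm_norm, mul_pow, inv_pow, sq_norm_tangentialProj_one hp]
  set t : ℝ := (‖p‖ ^ 2)⁻¹ with ht
  have ht0 : 0 ≤ t := by positivity
  have hle : ‖(‖p‖⁻¹ • tangentialProj p) (p - 1)‖ ^ 2 ≤ (1 / 2) ^ 2 := by
    rw [hsq]
    nlinarith [sq_nonneg (t - 1 / 2)]
  exact (pow_le_pow_iff_left₀ (norm_nonneg _) (by norm_num) two_ne_zero).1 hle

/-! ## §3 Letters: the radial projection along the gnomonic path, with either sign -/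

/-- ★★ **The gnomonic letter path is differentiable with speed `≤ 1/2`**: for `p_s = (1, e^s v)`,
`d/ds ν(p_s) = ‖p_s‖⁻¹·P_{p_s}(p_s − 1)` and its norm is `≤ 1/2` (✓`hasFDerivAt_radialUnit`, `norm_radialDeriv_le_half`). [folklore] -/
theorem hasDerivAt_radialUnit_gnomonic (v : Fin 3 → ℝ) (s : ℝ) :
    HasDerivAt (fun s : ℝ => radialUnit (gnomonicQuat (Real.exp s • v)))
      ((‖gnomonicQuat (Real.exp s • v)‖⁻¹ • tangentialProj (gnomonicQuat (Real.exp s • v))) (gnomonicQuat (Real.exp s • v) - 1)) s ∧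
    ‖(‖gnomonicQuat (Real.exp s • v)‖⁻¹ • tangentialProj (gnomonicQuat (Real.exp s • v))) (gnomonicQuat (Real.exp s • v) - 1)‖ ≤ 1 / 2 := by
  have hF := hasFDerivAt_radialUnit (E := ℍ) (x := gnomonicQuat (Real.exp s • v)) (gnomonicQuat_ne_zero _)
  have h := hF.comp_hasDerivAt s (hasDerivAt_gnomonicQuat_exp v s)
  exact ⟨h, norm_radialDeriv_le_half rfl⟩

/-- ★ `‖d/ds ν((1, e^s v))‖ ≤ 1/2`. [folklore] -/
theorem norm_deriv_radialUnit_gnomonic_le (v : Fin 3 → ℝ) (s : ℝ) :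
    ‖deriv (fun s : ℝ => radialUnit (gnomonicQuat (Real.exp s • v))) s‖ ≤ 1 / 2 := by
  rw [(hasDerivAt_radialUnit_gnomonic v s).1.deriv]
  exact (hasDerivAt_radialUnit_gnomonic v s).2

/-- The signed letter through `su2Quat ∘ quatToSU2` is `c·ν((1, w))` for `|c| = 1`. [folklore] -/
theorem su2Quat_quatToSU2_smul_gnomonicQuat {c : ℝ} (hc : |c| = 1) (w : Fin 3 → ℝ) :
    su2Quat (quatToSU2 (c • gnomonicQuat w)) = c • radialUnit (gnomonicQuat w) := by
  have hc0 : c ≠ 0 := by intro h; rw [h, abs_zero] at hc; exact zero_ne_one hc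
  rw [su2Quat_quatToSU2_eq_radialUnit (smul_ne_zero hc0 (gnomonicQuat_ne_zero w)), radialUnit_def, radialUnit_def, norm_smul, Real.norm_eq_abs,
    hc, one_mul, smul_smul, smul_smul, mul_comm]

/-- ★★ **THE LETTER SPEED BOUND** (the `gnoLetter` of the SPEC, either sign `c = ±1`): `s ↦ su2Quat (quatToSU2 (c·(1, e^s v)))` is differentiable with
`‖d/ds‖ ≤ 1/2` at every `s`. [folklore] -/
theorem hasDerivAt_letterQuat {c : ℝ} (hc : |c| = 1) (v : Fin 3 → ℝ) (s : ℝ) :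
    ∃ D : ℍ, HasDerivAt (fun s : ℝ => su2Quat (quatToSU2 (c • gnomonicQuat (Real.exp s • v)))) D s ∧ ‖D‖ ≤ 1 / 2 := by
  obtain ⟨hD, hle⟩ := hasDerivAt_radialUnit_gnomonic v s
  refine ⟨c • ((‖gnomonicQuat (Real.exp s • v)‖⁻¹ • tangentialProj (gnomonicQuat (Real.exp s • v))) (gnomonicQuat (Real.exp s • v) - 1)), ?_, ?_⟩
  · have e : (fun s : ℝ => su2Quat (quatToSU2 (c • gnomonicQuat (Real.exp s • v)))) = fun s => c • radialUnit (gnomonicQuat (Real.exp s • v)) :=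
      funext fun s => su2Quat_quatToSU2_smul_gnomonicQuat hc _
    rw [e]
    exact hD.const_smul c
  · rw [norm_smul, Real.norm_eq_abs, hc, one_mul]; exact hle

/-- ★ `‖d/ds su2Quat (quatToSU2 (c·(1, e^s v)))‖ ≤ 1/2` for `|c| = 1`. [folklore] -/
theorem norm_deriv_letterQuat_le {c : ℝ} (hc : |c| = 1) (v : Fin 3 → ℝ) (s : ℝ) :
    ‖deriv (fun s : ℝ => su2Quat (quatToSU2 (c • gnomonicQuat (Real.exp s • v)))) s‖ ≤ 1 / 2 := by
  obtain ⟨D, hD, hle⟩ := hasDerivAt_letterQuat hc v s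
  rw [hD.deriv]; exact hle

/-- The letter quaternion has norm `1`. [folklore] -/
theorem norm_letterQuat {c : ℝ} (hc : |c| = 1) (w : Fin 3 → ℝ) : ‖su2Quat (quatToSU2 (c • gnomonicQuat w))‖ = 1 := by
  rw [su2Quat_quatToSU2_smul_gnomonicQuat hc, norm_smul, Real.norm_eq_abs, hc, one_mul, norm_radialUnit (gnomonicQuat_ne_zero w)]

/-! ## §4 Words: products of letters of norm `≤ 1` -/

/-- ★ **Product rule with norms**: two quaternion paths of norm `≤ 1` with speeds `≤ a`, `≤ b` have a product with speed `≤ a + b`. [folklore] -/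
theorem hasDerivAt_mul_norm_le {f g : ℝ → ℍ} {f' g' : ℍ} {s a b : ℝ} (hf : HasDerivAt f f' s) (hg : HasDerivAt g g' s)
    (hf1 : ‖f s‖ ≤ 1) (hg1 : ‖g s‖ ≤ 1) (ha : ‖f'‖ ≤ a) (hb : ‖g'‖ ≤ b) :
    HasDerivAt (fun s => f s * g s) (f' * g s + f s * g') s ∧ ‖f' * g s + f s * g'‖ ≤ a + b := by
  refine ⟨hf.mul hg, ?_⟩
  · calc ‖f' * g s + f s * g'‖ ≤ ‖f' * g s‖ + ‖f s * g'‖ := norm_add_le _ _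
      _ ≤ ‖f'‖ * ‖g s‖ + ‖f s‖ * ‖g'‖ := add_le_add (norm_mul_le _ _) (norm_mul_le _ _)
      _ ≤ a * 1 + 1 * b := add_le_add (mul_le_mul ha hg1 (norm_nonneg _) ((norm_nonneg _).trans ha))
          (mul_le_mul hf1 hb (norm_nonneg _) zero_le_one)
      _ = a + b := by ring

/-- ★ **Words have speed at most the sum of the letter speeds**: a path `w` that is a product `f · g` of paths of norm `≤ 1` admits a derivative of norm
`≤ a + b`; in particular a word of `k` gnomonic letters has speed `≤ k/2` (iterate with `norm_letterQuat`, `hasDerivAt_letterQuat`). [folklore] -/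
theorem exists_hasDerivAt_mul_norm_le {f g : ℝ → ℍ} {s a b : ℝ} (hf : ∃ f' : ℍ, HasDerivAt f f' s ∧ ‖f'‖ ≤ a) (hg : ∃ g' : ℍ, HasDerivAt g g' s ∧ ‖g'‖ ≤ b)
    (hf1 : ‖f s‖ ≤ 1) (hg1 : ‖g s‖ ≤ 1) :
    ∃ w' : ℍ, HasDerivAt (fun s => f s * g s) w' s ∧ ‖w'‖ ≤ a + b := by
  obtain ⟨f', hf', ha⟩ := hf
  obtain ⟨g', hg', hb⟩ := hg
  exact ⟨_, (hasDerivAt_mul_norm_le hf' hg' hf1 hg1 ha hb).1, (hasDerivAt_mul_norm_le hf' hg' hf1 hg1 ha hb).2⟩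

end Summit.QuantumFields.YangMills.Theorems.SwapVirialDeficit.Gnomonic

end
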